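import Mathlib
import HarnessLib
import Summits.ResolutionOfSingularities.ResolutionOfSingularities.Theorems.WildQuotientsWildQuotientResolutionS1aChartStable
import Summits.ResolutionOfSingularities.ResolutionOfSingularities.Theorems.WildQuotientsWildQuotientResolutionS1aPrincipalCentreGood
import Literature.AlgebraicGeometry.Resolution.BlowupsExistence
import Summits.ResolutionOfSingularities.ResolutionOfSingularities.Theorems.WildQuotientsWildQuotientResolutionS1aReach

/-!
# S1a — THE SUPPORT LEMMA G1: a bad point of a principal-centre chart lies in the support of the centre

[OURS · L1 W4.5c · lead-1 g8; discharges `KillableTransport.G1` of p611093 ⇒ `jInf` is non-increasing under principal moves, `KillableAtOfIdle`,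
`PrincipalCentreRule ⇒ KillOrAuxRuleJInf` all become unconditional] — NOT statements of the manuscript; counted 0; AI-level work, weaker than expert
review. Crux stmt-ResolutionOfSingularities-17941, line `s1a-logminvertex` v6. Route-independent.

PROOF. Let `O` be a principal-centre chart of `(𝒦, d)` on the model `M`, `v ∈ O` OFF `supp(𝒦.ideal d)`; we show `v` is GOOD. Restrict to the affine
open subscheme `↑O` (chart `⊤`, `ChartStable.exists_isPrincipalCentreChart_restrict`; the restricted centre is `G`-stable,
`ChartStable.comap_restrict_aut_pullbackRees`), blow the centre up there (`exists_isBlowup`, lifted action `liftActionOver`), and apply the (T2e) chain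
`BlowupCharts.exists_killedNode_of_isPrincipalCentreChart`: the unique point `v₀'` over `v` (the blow-up is an isomorphism off the support) has a KILLED
tame node chart `O''`, whose `g₀`-fixed sections are a tame root chart (`isTameRootChart_gradeZero_invariants_pi`). An invariant basic open `D(b) ∋ v` of
`O` small enough that `θ⁻¹D(b) ⊆ O''` (`θ = π₀ ≫ O.ι`; finite intersection over `G` of an open image) has `θ⁻¹D(b) = D(θ^*b|_{O''})`, whose fixed
sections are tame (`isTameRootChart_eqLocus_basicOpen`); and `θ` induces an EQUIVARIANT ISOMORPHISM `Γ(V, D(b)) ≅ Γ(V₀', θ⁻¹D(b))`, so the fixed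
sections of `Γ(V, D(b))` are tame: `M` is good at `v` (`isGoodAt_of_tame_eqLocus`).

* `eqLocusEquiv` — fixed subrings transport along intertwining ring isos; `isTameRootChart_eqLocus_of_appLE_iso` (LEMMA T): tame fixed sections
  transport DOWN an equivariant morphism inducing an iso on the sections of a stable open;
* **`g1 : p.Prime → KillableTransport.G1 p`**; corollaries **`jInf_move_le`**, `killAlt_of_principalCentre`, **`killOrAuxRuleJInf_of_principalCentreRule`**.
-/

set_option linter.dupNamespace false

noncomputable section

open CategoryTheory AlgebraicGeometry TopologicalSpace Topology
open Literature.AlgebraicGeometry.Resolution Literature.AlgebraicGeometry.RelativeSpec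
open Summit.ResolutionOfSingularities.ResolutionOfSingularities.Theorems.WildQuotientResolution.S1
open Summit.ResolutionOfSingularities.ResolutionOfSingularities.Theorems.WildQuotientResolution.S1.NodeAtlas
open Summit.ResolutionOfSingularities.ResolutionOfSingularities.Theorems.WildQuotientResolution.S1.GoodCharts
open Summit.ResolutionOfSingularities.ResolutionOfSingularities.Theorems.WildQuotientResolution.S1.BlowupCharts
open Summit.ResolutionOfSingularities.ResolutionOfSingularities.Theorems.WildQuotientResolution.S1.MoveStep
open Summit.ResolutionOfSingularities.ResolutionOfSingularities.Theorems.WildQuotientResolution.S1.InvariantsRegular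
open Summit.ResolutionOfSingularities.ResolutionOfSingularities.Theorems.WildQuotientResolution.S1.KillableTransport
open Summit.ResolutionOfSingularities.ResolutionOfSingularities.Theorems.WildQuotientResolution.S1.ChartStable

namespace Summit.ResolutionOfSingularities.ResolutionOfSingularities.Theorems.WildQuotientResolution.S1.G1Proof

universe u

/-! ## Fixed subrings along intertwining isomorphisms -/

/-- **Fixed subrings transport along a ring iso intertwining the endomorphisms.** [OURS · L1 W4.5c] -/
def eqLocusEquiv {A A' : Type*} [CommRing A] [CommRing A'] (E : A ≃+* A') (τ : A →+* A) (τ' : A' →+* A') (h : ∀ x, E (τ x) = τ' (E x)) :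
    ↥(RingHom.eqLocus τ (RingHom.id A)) ≃+* ↥(RingHom.eqLocus τ' (RingHom.id A')) where
  toFun x := ⟨E x, by
    have hx : τ x.1 = x.1 := x.2
    change τ' (E x.1) = E x.1
    rw [← h, hx]⟩
  invFun y := ⟨E.symm y, by
    have hy : τ' y.1 = y.1 := y.2
    change τ (E.symm y.1) = E.symm y.1
    apply E.injective
    rw [h, E.apply_symm_apply, hy]⟩
  left_inv x := Subtype.ext (E.symm_apply_apply x.1)
  right_inv y := Subtype.ext (E.apply_symm_apply y.1)
  map_mul' x y := Subtype.ext (map_mul E x.1 y.1)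
  map_add' x y := Subtype.ext (map_add E x.1 y.1)

/-! ## LEMMA T: tame fixed sections descend along an equivariant morphism inducing an iso on sections -/

section Descend

variable {V₁ V₂ Y : Scheme.{u}} {r₁ : V₁ ⟶ Y} {r₂ : V₂ ⟶ Y} {G : Type u} [Group G] (ρ₁ : ActionOver r₁ G) (ρ₂ : ActionOver r₂ G)
  (θ : V₁ ⟶ V₂) (hcomm : ∀ g : G, (ρ₁.aut g).hom ≫ θ = θ ≫ (ρ₂.aut g).hom) (g₀ : G)

include hcomm in
/-- **LEMMA T.** If `θ` is equivariant, `U₂` is `ρ₂`-stable, `U₁ = θ⁻¹ U₂`, and `θ.appLE U₂ (θ⁻¹U₂)` is an ISOMORPHISM, then tameness of the `g₀`-fixed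
sections transports from `Γ(V₁, U₁)` to `Γ(V₂, U₂)`. [OURS · L1 W4.5c] -/
theorem isTameRootChart_eqLocus_of_appLE_iso (U₂ : V₂.Opens) (hU₂ : ∀ g : G, (ρ₂.aut g).hom ⁻¹ᵁ U₂ = U₂) (U₁ : V₁.Opens)
    (hU₁ : U₁ = θ ⁻¹ᵁ U₂) (hU₁st : ∀ g : G, (ρ₁.aut g).hom ⁻¹ᵁ U₁ = U₁) (hiso : IsIso (θ.appLE U₂ (θ ⁻¹ᵁ U₂) le_rfl))
    (htame : IsTameRootChart ↥(RingHom.eqLocus ((ρ₁.aut g₀⁻¹).hom.appLE U₁ U₁ (hU₁st g₀⁻¹).ge).hom (RingHom.id _))) :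
    IsTameRootChart ↥(RingHom.eqLocus ((ρ₂.aut g₀⁻¹).hom.appLE U₂ U₂ (hU₂ g₀⁻¹).ge).hom (RingHom.id _)) := by
  subst hU₁
  haveI := hiso
  obtain ⟨P, hPapply⟩ : ∃ P : Γ(V₂, U₂) ≃+* Γ(V₁, θ ⁻¹ᵁ U₂), ∀ s, P s = θ.appLE U₂ (θ ⁻¹ᵁ U₂) le_rfl s :=
    ⟨(asIso (θ.appLE U₂ (θ ⁻¹ᵁ U₂) le_rfl)).commRingCatIsoToRingEquiv, fun _ => rfl⟩
  have hP : ∀ s, P (((ρ₂.aut g₀⁻¹).hom.appLE U₂ U₂ (hU₂ g₀⁻¹).ge).hom s) =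
      ((ρ₁.aut g₀⁻¹).hom.appLE (θ ⁻¹ᵁ U₂) (θ ⁻¹ᵁ U₂) (hU₁st g₀⁻¹).ge).hom (P s) := fun s => by
    rw [hPapply, hPapply]
    exact (appLE_comm_of_le ρ₂ ρ₁ hcomm U₂ hU₂ (θ ⁻¹ᵁ U₂) hU₁st le_rfl g₀⁻¹ s).symm
  exact IsTameRootChart.of_ringEquiv (eqLocusEquiv P _ _ hP) htame

end Descend

/-! ## A `G`-stable open neighbourhood whose preimage lies in a given stable open upstairs -/

section Nbhd

variable {V' V : Scheme.{u}} {G : Type u} [Group G] [Finite G]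

/-- Finite intersection of the translates of an open set is a `G`-stable open (for a group of homeomorphisms given by a hom `G → Aut V`). -/
theorem exists_stable_open_subset (aut : G → (V ≅ V)) (haut : ∀ g h (x : V), (aut g).hom.base ((aut h).hom.base x) = (aut (g * h)).hom.base x)
    (N₁ : Set V) (hN₁ : IsOpen N₁) (v : V) (hv : ∀ g : G, (aut g).hom.base v ∈ N₁) :
    ∃ N : V.Opens, v ∈ N ∧ (N : Set V) ⊆ N₁ ∧ ∀ g : G, (aut g).hom ⁻¹ᵁ N = N := by
  refine ⟨⟨⋂ g : G, (fun x => (aut g).hom.base x) ⁻¹' N₁, isOpen_iInter_of_finite fun g => hN₁.preimage (aut g).hom.continuous⟩,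
    Set.mem_iInter.mpr hv, fun x hx => ?_, fun h => ?_⟩
  · have h1 := Set.mem_iInter.mp hx 1
    have hone : (aut 1).hom.base x = x := by
      have := haut 1 1 x
      rw [mul_one] at this
      -- `aut 1 ∘ aut 1 = aut 1` and `aut 1` is a bijection
      exact (Scheme.homeoOfIso (aut 1)).injective (by rw [Scheme.coe_homeoOfIso]; exact this)
    rwa [Set.mem_preimage, hone] at h1
  · ext x
    change (aut h).hom.base x ∈ ⋂ g : G, (fun x => (aut g).hom.base x) ⁻¹' N₁ ↔ x ∈ ⋂ g : G, (fun x => (aut g).hom.base x) ⁻¹' N₁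
    simp only [Set.mem_iInter, Set.mem_preimage]
    constructor
    · intro H g
      have := H (g * h⁻¹)
      rwa [haut, inv_mul_cancel_right] at this
    · intro H g
      rw [haut]
      exact H (g * h)

end Nbhd

/-! ## G1 -/

section Main

variable {p : ℕ} {X' X₁ : Scheme.{0}} {q : X' ⟶ X₁} {G : Type} [Group G] {ρ : G →* Aut X'} {g₀ : G}

/-- **G1 — A BAD POINT OF A PRINCIPAL-CENTRE CHART LIES IN THE SUPPORT OF THE CENTRE.** [OURS · L1 W4.5c] -/
theorem goodAt_of_not_mem_support [Finite G] (hp : p.Prime) (hG : ∀ g : G, g ∈ Subgroup.zpowers g₀) (M : GameFrame.GModel p q G ρ g₀)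
    (𝒦 : ReesFiltration M.V) (d : ℕ) (O : M.act.StableAffineOpens) (hB : M.HasNoetherianBase) (hO : IsPrincipalCentreChart p M.act g₀ 𝒦 d O)
    {v : M.V} (hvO : v ∈ O.1) (hvs : v ∉ ((𝒦.ideal d).support : Set M.V)) : M.IsGoodAt v := by
  classical
  have hOaff : IsAffineOpen O.1 := hO.1
  obtain ⟨R₀, _, _, s, _, hs⟩ := hB
  -- (1) restrict to the affine open subscheme `↑O`
  let ρ₀ := M.act.restrict O.1 O.2.1
  let 𝒦₀ := pullbackRees 𝒦 O.1.ι
  let I₀ : (O.1 : Scheme.{0}).IdealSheafData := 𝒦₀.ideal d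
  have hρ₀ : ∀ g : G, I₀.comap (ρ₀.aut g).hom = I₀ := fun g => comap_restrict_aut_pullbackRees M.act O hG hO hOaff g d
  obtain ⟨O₀, hO₀eq, hkill₀⟩ := exists_isPrincipalCentreChart_restrict M.act g₀ 𝒦 d O hO
  -- (2) blow up the restricted centre; lift the action
  obtain ⟨V₀', π₀, hπ₀⟩ := exists_isBlowup (O.1 : Scheme.{0}) I₀
  let ρ₀' := liftActionOver ρ₀ hπ₀ hρ₀
  have hcomm₀ : ∀ g : G, (ρ₀'.aut g).hom ≫ π₀ = π₀ ≫ (ρ₀.aut g).hom := liftActionOver_aut_hom_comp ρ₀ hπ₀ hρ₀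
  -- the base
  haveI : LocallyOfFiniteType (O.1.ι ≫ s) := inferInstance
  have hs₀ : ∀ g : G, (ρ₀.aut g).hom ≫ O.1.ι ≫ s = O.1.ι ≫ s := fun g => by
    rw [ActionOver.restrict_aut_hom, ActionOver.restrictHom_ι_assoc, hs g]
  -- (3) the point upstairs: `π₀` is an isomorphism over `W₀ = (supp I₀)ᶜ ∋ v₀`
  let v₀ : (O.1 : Scheme.{0}) := ⟨v, hvO⟩
  have hv₀ : v₀ ∉ (I₀.support : Set (O.1 : Scheme.{0})) := by
    change v₀ ∉ (((𝒦.ideal d).comap O.1.ι).support : Set (O.1 : Scheme.{0}))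
    rw [Scheme.IdealSheafData.support_comap]
    exact hvs
  let W₀ : (O.1 : Scheme.{0}).Opens := I₀.support.compl
  haveI hisoW : IsIso (π₀ ∣_ W₀) := hπ₀.isIso_morphismRestrict (U := W₀) (by
    rw [Set.disjoint_iff]; rintro x ⟨hx, hx'⟩; exact hx hx')
  let h₀ : ↥(π₀ ⁻¹ᵁ W₀) ≃ₜ ↥W₀ := Scheme.homeoOfIso (asIso (π₀ ∣_ W₀))
  let v₀' : V₀' := (h₀.symm ⟨v₀, hv₀⟩).1
  have hπv₀' : π₀.base v₀' = v₀ := by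
    have h1 : ((h₀ (h₀.symm ⟨v₀, hv₀⟩) : ↥W₀) : (O.1 : Scheme.{0})) = v₀ := by rw [h₀.apply_symm_apply]
    rw [← h1]
    exact (morphismRestrict_base_coe π₀ W₀ (h₀.symm ⟨v₀, hv₀⟩)).symm
  have hv₀'O₀ : π₀.base v₀' ∈ O₀.1 := by
    rw [hO₀eq, hπv₀']
    change O.1.ι.base v₀ ∈ O.1
    rw [Scheme.Opens.ι_apply]
    exact hvO
  -- (4) the killed node chart at `v₀'`
  obtain ⟨O'', hv₀'O'', hO''aff, m, r, B', _, 𝒜', _, σ', e', hnode', he', hI', φ₀, hφ₀, hφσ, hφ0⟩ :=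
    exists_killedNode_of_isPrincipalCentreChart ρ₀ hπ₀ hρ₀ ρ₀' hcomm₀ g₀ rfl hp hG 𝒦₀ d rfl O₀ hkill₀ (O.1.ι ≫ s) hs₀ v₀' hv₀'O₀
  -- its `g₀`-fixed sections are a tame root chart
  have htameO'' : IsTameRootChart ↥(RingHom.eqLocus (actO ρ₀' O'' g₀) (RingHom.id _)) := by
    letI : Algebra R₀ B' := φ₀.toAlgebra
    haveI : Algebra.FiniteType R₀ B' := hφ₀
    have h := isTameRootChart_gradeZero_invariants_pi r 𝒜' σ' hp hnode' hI' hφσ hφ0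
    refine IsTameRootChart.of_ringEquiv (eqLocusEquiv e' (actO ρ₀' O'' g₀)
      (((σ' : B' →+* B').comp (SetLike.GradeZero.subring 𝒜').subtype).codRestrict (SetLike.GradeZero.subring 𝒜')
        (fun x => hnode'.2.2.2.2.1 0 x.1 x.2)) fun t => Subtype.ext (he' t)) h
  -- (5) the equivariant morphism `θ : V₀' → M.V`
  let θ : V₀' ⟶ M.V := π₀ ≫ O.1.ι
  have hcommθ : ∀ g : G, (ρ₀'.aut g).hom ≫ θ = θ ≫ (M.act.aut g).hom := fun g => by
    change (ρ₀'.aut g).hom ≫ π₀ ≫ O.1.ι = (π₀ ≫ O.1.ι) ≫ (M.act.aut g).hom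
    rw [← Category.assoc, hcomm₀ g, Category.assoc, Category.assoc]
    congr 1
    rw [ActionOver.restrict_aut_hom, ActionOver.restrictHom_ι]
  have hθpt : ∀ g (x' : V₀'), θ.base ((ρ₀'.aut g).hom.base x') = (M.act.aut g).hom.base (θ.base x') := fun g x' => by
    rw [← Scheme.Hom.comp_apply, hcommθ g, Scheme.Hom.comp_apply]
  -- (6) a `G`-stable open `N ∋ v` with `θ⁻¹ N ⊆ O''`: translates of the image of `O'' ∩ π₀⁻¹ W₀`
  let A : Set ↥(π₀ ⁻¹ᵁ W₀) := Subtype.val ⁻¹' (O''.1 : Set V₀')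
  let N₁ : Set M.V := (fun y : ↥W₀ => O.1.ι.base y.1) '' (h₀ '' A)
  have hN₁open : IsOpen N₁ := by
    have h1 : IsOpen (h₀ '' A) := h₀.isOpenMap _ (O''.1.isOpen.preimage continuous_subtype_val)
    have h2 : IsOpenEmbedding (fun y : ↥W₀ => O.1.ι.base y.1) :=
      O.1.ι.isOpenEmbedding.comp W₀.2.isOpenEmbedding_subtypeVal
    exact h2.isOpenMap _ h1
  -- points of `N₁` come from `O''`, and `θ⁻¹ N₁ ⊆ O''`
  have hN₁sub : ∀ x' : V₀', θ.base x' ∈ N₁ → x' ∈ O''.1 ∧ π₀.base x' ∈ W₀ := by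
    rintro x' ⟨y, ⟨z, hzA, rfl⟩, hy⟩
    change O.1.ι.base (h₀ z).1 = (π₀ ≫ O.1.ι).base x' at hy
    rw [Scheme.Hom.comp_apply] at hy
    have hπ : π₀.base x' = (h₀ z).1 := (O.1.ι.isOpenEmbedding.injective hy).symm
    have hW : π₀.base x' ∈ W₀ := by rw [hπ]; exact (h₀ z).2
    refine ⟨?_, hW⟩
    have hz : h₀ ⟨x', hW⟩ = h₀ z := by
      apply Subtype.ext
      change ((π₀ ∣_ W₀).base ⟨x', hW⟩).1 = (h₀ z).1
      rw [morphismRestrict_base_coe]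
      exact hπ
    have := h₀.injective hz
    rw [← this] at hzA
    exact hzA
  have hmemN₁ : ∀ x' : V₀', x' ∈ O''.1 → π₀.base x' ∈ W₀ → θ.base x' ∈ N₁ := fun x' hx' hW =>
    ⟨h₀ ⟨x', hW⟩, ⟨⟨x', hW⟩, hx', rfl⟩, by
      change O.1.ι.base ((π₀ ∣_ W₀).base ⟨x', hW⟩).1 = (π₀ ≫ O.1.ι).base x'
      rw [morphismRestrict_base_coe, Scheme.Hom.comp_apply]⟩
  have hθv₀' : θ.base v₀' = v := by
    change (π₀ ≫ O.1.ι).base v₀' = v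
    rw [Scheme.Hom.comp_apply, hπv₀', Scheme.Opens.ι_apply]
  have hW₀st : ∀ g : G, (ρ₀'.aut g).hom ⁻¹ᵁ (π₀ ⁻¹ᵁ W₀) = π₀ ⁻¹ᵁ W₀ := by
    intro g
    rw [← Scheme.Hom.comp_preimage, hcomm₀ g, Scheme.Hom.comp_preimage]
    congr 1
    ext x
    change (ρ₀.aut g).hom.base x ∈ ((I₀.support : Set _))ᶜ ↔ x ∈ ((I₀.support : Set _))ᶜ
    rw [Set.mem_compl_iff, Set.mem_compl_iff, not_iff_not]
    have h := congrArg (fun J : (O.1 : Scheme.{0}).IdealSheafData => SetLike.coe J.support) (hρ₀ g)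
    simp only [Scheme.IdealSheafData.support_comap, TopologicalSpace.Closeds.coe_preimage] at h
    exact Set.ext_iff.mp h x
  obtain ⟨N, hvN, hNN₁, hNst⟩ := exists_stable_open_subset (V := M.V) (fun g => M.act.aut g)
    (fun g h x => by rw [map_mul, Aut.Aut_mul_def, Iso.trans_hom, Scheme.Hom.comp_apply]) N₁ hN₁open v fun g => by
      rw [← hθv₀', ← hθpt]
      refine hmemN₁ _ ?_ ?_
      · have : v₀' ∈ (ρ₀'.aut g).hom ⁻¹ᵁ O''.1 := by rw [O''.2.1 g]; exact hv₀'O''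
        exact this
      · have hvW : v₀' ∈ π₀ ⁻¹ᵁ W₀ := (h₀.symm ⟨v₀, hv₀⟩).2
        have : v₀' ∈ (ρ₀'.aut g).hom ⁻¹ᵁ (π₀ ⁻¹ᵁ W₀) := by rw [hW₀st g]; exact hvW
        exact this
  -- (7) an invariant basic open `D(b) ∋ v` of `O` inside `N`
  obtain ⟨b, hb, hvb, hbN⟩ := exists_invariant_basicOpen M.act O hOaff hvO N hNst hvN
  have hsub : ∀ x' : V₀', x' ∈ θ ⁻¹ᵁ M.V.basicOpen b → x' ∈ O''.1 ∧ π₀.base x' ∈ W₀ := fun x' hx' =>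
    hN₁sub x' (hNN₁ (hbN hx'))
  -- the pulled-back invariant section and its basic open `= θ⁻¹ D(b)`
  have hle : O''.1 ≤ θ ⁻¹ᵁ O.1 := fun x' _ => by
    change (π₀ ≫ O.1.ι).base x' ∈ O.1
    rw [Scheme.Hom.comp_apply, Scheme.Opens.ι_apply]
    exact (π₀.base x').2
  let t₀ : Γ(V₀', O''.1) := θ.appLE O.1 O''.1 hle b
  have ht₀ : ∀ g : G, actO ρ₀' O'' g t₀ = t₀ := fun g => by
    change (ρ₀'.aut g⁻¹).hom.appLE O''.1 O''.1 (O''.2.1 g⁻¹).ge (θ.appLE O.1 O''.1 hle b) = θ.appLE O.1 O''.1 hle b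
    rw [appLE_comm_of_le M.act ρ₀' hcommθ O.1 O.2.1 O''.1 O''.2.1 hle g⁻¹ b]
    exact congrArg _ (hb g)
  have hU₁ : V₀'.basicOpen t₀ = θ ⁻¹ᵁ M.V.basicOpen b := by
    rw [Scheme.basicOpen_appLE]
    exact inf_eq_right.mpr fun x' hx' => (hsub x' hx').1
  have htame₁ := isTameRootChart_eqLocus_basicOpen ρ₀' O'' (g₀ := g₀) hO''aff ht₀ htameO''
  -- (8) `θ` induces an iso on sections over `D(b)` (iso region of `π₀`, then the open immersion `O.ι`)
  have hiso : IsIso (θ.appLE (M.V.basicOpen b) (θ ⁻¹ᵁ M.V.basicOpen b) le_rfl) := by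
    have hdisj : Disjoint ((O.1.ι ⁻¹ᵁ M.V.basicOpen b : (O.1 : Scheme.{0}).Opens) : Set (O.1 : Scheme.{0})) I₀.support := by
      rw [Set.disjoint_iff]
      rintro y ⟨hy, hy'⟩
      -- `y = π₀ y'` for the point `y'` over it in the iso region? Easier: `O.ι y ∈ D(b) ⊆ N₁ ⊆ ι(W₀)`.
      obtain ⟨z, ⟨w, -, rfl⟩, hz⟩ := hNN₁ (hbN hy)
      have : (h₀ w).1 = y := O.1.ι.isOpenEmbedding.injective hz
      exact (this ▸ (h₀ w).2) hy'
    haveI h1 : IsIso (π₀ ∣_ (O.1.ι ⁻¹ᵁ M.V.basicOpen b)) := hπ₀.isIso_morphismRestrict hdisj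
    haveI h2 : IsIso (π₀.appLE (O.1.ι ⁻¹ᵁ M.V.basicOpen b) (π₀ ⁻¹ᵁ (O.1.ι ⁻¹ᵁ M.V.basicOpen b)) le_rfl) :=
      isIso_app_of_isIso_morphismRestrict _ h1
    haveI h3 : IsIso (O.1.ι.appLE (M.V.basicOpen b) (O.1.ι ⁻¹ᵁ M.V.basicOpen b) le_rfl) := by
      rw [← Scheme.Hom.app_eq_appLE]
      exact O.1.ι.isIso_app _ (by rw [Scheme.Opens.opensRange_ι]; exact M.V.basicOpen_le b)
    have h4 : IsIso (O.1.ι.appLE (M.V.basicOpen b) (O.1.ι ⁻¹ᵁ M.V.basicOpen b) le_rfl ≫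
        π₀.appLE (O.1.ι ⁻¹ᵁ M.V.basicOpen b) (π₀ ⁻¹ᵁ (O.1.ι ⁻¹ᵁ M.V.basicOpen b)) le_rfl) := IsIso.comp_isIso
    rw [Scheme.Hom.appLE_comp_appLE] at h4
    exact h4
  -- (9) descend tameness to `D(b) ⊆ M.V`, and conclude
  have hDst := preimage_basicOpen_of_invariant M.act O hb
  have htame₂ := isTameRootChart_eqLocus_of_appLE_iso ρ₀' M.act θ hcommθ g₀ (M.V.basicOpen b) hDst (V₀'.basicOpen t₀) hU₁
    (preimage_basicOpen_of_invariant ρ₀' O'' ht₀) hiso htame₁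
  exact M.isGoodAt_of_tame_eqLocus hG (NodeChartAway.basicOpenStable M.act O hOaff hb) (NodeChartAway.isAffineOpen_basicOpenStable M.act O hOaff hb)
    htame₂ hvb

/-- **G1 HOLDS** (for prime `p`). [OURS · L1 W4.5c] -/
theorem g1 (hp : p.Prime) : G1 p := by
  intro X' X₁ q G _ _ ρ g₀ hG M 𝒦 d O hB hO v hvO hbad
  by_contra hvs
  exact hbad (goodAt_of_not_mem_support hp hG M 𝒦 d O hB hO hvO hvs)

/-- **`jInf` DOES NOT INCREASE UNDER A PRINCIPAL MOVE** (`JInfPrincipalMoveLe` of SIG v3, now unconditional). [OURS · L1 W4.5c] -/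
theorem jInf_move_le [Finite G] (hp : p.Prime) (hG : ∀ g : G, g ∈ Subgroup.zpowers g₀) (M M' : GameFrame.GModel p q G ρ g₀)
    (𝒦 : ReesFiltration M.V) (d : ℕ) (hprin : IsPrincipalCentre p M.act g₀ 𝒦 d) (hB : M.HasNoetherianBase) (hmv : M.IsMoveOf M' 𝒦 d) :
    M'.jInf ≤ M.jInf :=
  jInf_move_le_of_G1 (g1 hp) hp hG M M' 𝒦 d hprin hB hmv

/-- **A principal centre meeting every bad component is a KILL alternative of the rule of record** (unconditional). [OURS · L1 W4.5c] -/
theorem killAlt_of_principalCentre [Finite G] (hp : p.Prime) (hG : ∀ g : G, g ∈ Subgroup.zpowers g₀) (M : GameFrame.GModel p q G ρ g₀)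
    (hB : M.HasNoetherianBase) {𝒦 : ReesFiltration M.V} {d : ℕ} (hprin : IsPrincipalCentre p M.act g₀ 𝒦 d)
    (hhit : ∀ t ∈ irreducibleComponents ↥M.badLocus, ∃ x ∈ t, (x : M.V) ∈ M.principalKillOpen 𝒦 d) : M.KillAlt :=
  killAlt_of_principalCentre_of_G1 (g1 hp) hp hG M hB hprin hhit

end Main

/-- **THE ONE-PHASE RULE IMPLIES THE RULE OF RECORD**: `PrincipalCentreRule p → KillOrAuxRuleJInf p` (unconditional). [OURS · L1 W4.5c] -/
theorem killOrAuxRuleJInf_of_principalCentreRule {p : ℕ} (hp : p.Prime) (hrule : PrincipalCentreRule p) : KillOrAuxRuleJInf p :=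
  killOrAuxRuleJInf_of_principalCentreRule_of_G1 (g1 hp) hp hrule

end Summit.ResolutionOfSingularities.ResolutionOfSingularities.Theorems.WildQuotientResolution.S1.G1Proof

end
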